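import Mathlib
import Literature.Analysis.Asymptotics.KaramataTauberianLaplaceTwo
import HarnessLib

/-!
# Stub `stub_karamataCollapse` (K) of line `KaramataCollapse` (idea `subadditive-karamata-collapse`)
(crux `CoercivePulse.LinearSpread`, item stmt-AtomisticToContinuum-15382; `--supports` file, closes nothing)

WHAT. The registered stub K of the crux skeleton (`Cruxes/LinearSpread/Lines/KaramataCollapse.lean`), a statement of
pure real analysis: let `f = σ²` on `[0,∞)` with `σ ≥ 0` and the two-sided increment bound `|σ t − σ s| ≤ σ (t − s)`
(`0 ≤ s ≤ t`), a linear ceiling `f t ≤ b (1 + t)`, Laplace integrability of `e^{−νt} f` on `(0,∞)` for every `ν > 0`,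
Abel regularity (`ν² ∫₀^∞ e^{−νt} f` converges in `ℝ` or tends to `+∞` as `ν ↓ 0`) and infinitely-often linear growth
(`∃ m₀ > 0 ∀ t₀ ∃ t ≥ t₀, m₀ t ≤ f t`). Then `f t ≥ m t` for all large `t`, for some `m > 0`.

HOW (Karamata collapse; Feller XIII.5 Theorem 2 with `ρ = 2` plus a slow-decrease argument).
* WLOG `b ≥ 0` (`f = σ² ≥ 0`).
* The ceiling kills the `+∞` branch: `ν² ∫₀^∞ e^{−νt} f ≤ ν² (b/ν + b/ν²) ≤ 2b` for `0 < ν ≤ 1`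
  (`laplace_sq_mul_le`), so the Abel means converge to some `L`.
* Karamata's Tauberian theorem of index 2 (`Literature.Analysis.Asymptotics.karamata_tauberian_laplace_two`, proved in
  the tree) gives `F(T)/T² → L/2` for `F(T) = ∫_{(0,T]} f`.
* Local transfer (`sq_transfer`): from `σ s ≤ σ t + σ (t − s)` and `(B + C)² ≤ 2B² + 2C²`,
  `f s ≤ 2 f t + 2 f (t − s)` for `0 ≤ s ≤ t`; with the ceiling, `f (t − s) ≤ b (1 + θ t)` on windows of length `θ t`.
* `L > 0`: at an io-time `t` (`f t ≥ m₀ t`) the transfer gives `f ≥ m₀ t/2 − b(1 + θt)` on `[t, (1+θ)t]`, so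
  `F((1+θ)t) ≥ θ t (m₀ t/2 − b − bθt)`, while `L ≤ 0` and Karamata give `F((1+θ)t) ≤ ε (1+θ)² t²`; with `bθ ≤ m₀/8`,
  `ε = θ m₀/32` this forces `m₀ t ≤ 4b`, absurd for large io-times.
* Envelope: for large `t` and `a = (1−θ)t`, Karamata gives `F t − F a ≥ θ t · L t/2` (`ε = Lθ/8`, `θ ≤ 1/2`), the
  transfer gives `F t − F a ≤ θ t (2 f t + 2b + 2bθt)`; with `bθ ≤ L/16` this yields `f t ≥ (L/8) t` once `t ≥ 16 b/L`.
Mathlib only, plus the Literature Karamata file (its `KaramataLaplace.*` Laplace bookkeeping is reused).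
-/

noncomputable section

namespace Summit.AtomisticToContinuum.FouriersLaw.Theorems.LinearSpread.KaramataCollapse

open MeasureTheory Filter Set
open scoped Topology
open Literature.Analysis.Asymptotics

/-- Local transfer of the size of `f = σ²` along the increment bound: for `0 ≤ s ≤ t`,
`f s ≤ 2 f t + 2 f (t − s)` (from `σ s ≤ σ t + σ (t − s)`). Read with the roles of `s, t` exchanged it is also the
slow-decrease estimate `f t ≥ f s / 2 − f (t − s)`. [folklore] -/
theorem sq_transfer {f σ : ℝ → ℝ} (hσ : ∀ t : ℝ, 0 ≤ t → 0 ≤ σ t)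
    (hinc : ∀ s t : ℝ, 0 ≤ s → s ≤ t → |σ t - σ s| ≤ σ (t - s))
    (hf : ∀ t : ℝ, 0 ≤ t → f t = σ t ^ 2) {s t : ℝ} (hs : 0 ≤ s) (hst : s ≤ t) :
    f s ≤ 2 * f t + 2 * f (t - s) := by
  have h := (abs_le.1 (hinc s t hs hst)).1
  have ht : 0 ≤ t := hs.trans hst
  have hts : 0 ≤ t - s := sub_nonneg.2 hst
  have hle : σ s ≤ σ t + σ (t - s) := by linarith
  rw [hf s hs, hf t ht, hf (t - s) hts]
  nlinarith [mul_self_le_mul_self (hσ s hs) hle, sq_nonneg (σ t - σ (t - s))]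

/-- `∫₀^∞ e^{−νt} · b(1+t) dt = b/ν + b/ν²` for `ν > 0`, with integrability. [folklore] -/
theorem integral_exp_neg_mul_linear {ν : ℝ} (hν : 0 < ν) (b : ℝ) :
    IntegrableOn (fun t : ℝ => Real.exp (-(ν * t)) * (b * (1 + t))) (Ioi 0) ∧
      ∫ t in Ioi (0:ℝ), Real.exp (-(ν * t)) * (b * (1 + t)) = b * (1 / ν) + b * (1 / ν ^ 2) := by
  have h0 := KaramataLaplace.integrableOn_exp_neg_mul_Ioi hν
  have h0v := KaramataLaplace.integral_exp_neg_mul_Ioi hν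
  have h1 := KaramataLaplace.hint_id ν hν
  have h1v := KaramataLaplace.laplace_id hν
  unfold KaramataLaplace.laplace at h1v
  have hfun : (fun t : ℝ => Real.exp (-(ν * t)) * (b * (1 + t))) =
      fun t => b * Real.exp (-(ν * t)) + b * (t * Real.exp (-(ν * t))) := by
    funext t; ring
  rw [hfun]
  refine ⟨(h0.const_mul b).add (h1.const_mul b), ?_⟩
  rw [integral_add (h0.const_mul b) (h1.const_mul b), integral_const_mul, integral_const_mul, h0v, h1v]

/-- The linear ceiling bounds the Abel means: if `f t ≤ b(1+t)` on `t ≥ 0` (`b ≥ 0`) and `e^{−νt} f` is integrable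
on `(0,∞)`, then `ν² ∫₀^∞ e^{−νt} f ≤ bν + b ≤ 2b` for `0 < ν ≤ 1`. [folklore] -/
theorem laplace_sq_mul_le {f : ℝ → ℝ} {b ν : ℝ} (hb0 : 0 ≤ b) (hb : ∀ t : ℝ, 0 ≤ t → f t ≤ b * (1 + t))
    (hν : 0 < ν) (hν1 : ν ≤ 1) (hint : IntegrableOn (fun t : ℝ => Real.exp (-(ν * t)) * f t) (Ioi 0)) :
    ν ^ 2 * ∫ t in Ioi (0:ℝ), Real.exp (-(ν * t)) * f t ≤ 2 * b := by
  obtain ⟨hi, hv⟩ := integral_exp_neg_mul_linear hν b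
  have hle : ∫ t in Ioi (0:ℝ), Real.exp (-(ν * t)) * f t ≤
      ∫ t in Ioi (0:ℝ), Real.exp (-(ν * t)) * (b * (1 + t)) :=
    setIntegral_mono_on hint hi measurableSet_Ioi fun t ht =>
      mul_le_mul_of_nonneg_left (hb t (le_of_lt ht)) (Real.exp_pos _).le
  rw [hv] at hle
  have h1 : ν ^ 2 * (b * (1 / ν) + b * (1 / ν ^ 2)) = b * ν + b := by
    field_simp
  calc ν ^ 2 * ∫ t in Ioi (0:ℝ), Real.exp (-(ν * t)) * f t
      ≤ ν ^ 2 * (b * (1 / ν) + b * (1 / ν ^ 2)) := mul_le_mul_of_nonneg_left hle (by positivity)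
    _ = b * ν + b := h1
    _ ≤ 2 * b := by nlinarith [mul_le_mul_of_nonneg_left hν1 hb0]

/-- **Stub K — `karamataCollapse`** (registered stub 1 of line `KaramataCollapse` of crux `CoercivePulse.LinearSpread`,
stmt-AtomisticToContinuum-15382; statement verbatim). For `f = σ²` on `[0,∞)` with `σ ≥ 0`, the two-sided increment
bound `|σ t − σ s| ≤ σ (t − s)` (`0 ≤ s ≤ t`), a linear ceiling `f t ≤ b(1+t)`, Laplace integrability of `e^{−νt} f`
for every `ν > 0`, Abel regularity (`ν²∫₀^∞e^{−νt}f` converges in `ℝ` or tends to `+∞` as `ν ↓ 0`) and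
infinitely-often linear growth (`∃ m₀ > 0 ∀ t₀ ∃ t ≥ t₀, m₀ t ≤ f t`): `f t ≥ m·t` eventually for some `m > 0`.
Proof: the ceiling kills the `atTop` branch; Karamata's Tauberian theorem of index 2
(`Literature.Analysis.Asymptotics.karamata_tauberian_laplace_two`) gives `(∫₀ᵀ f)/T² → L/2`; the local transfer
`sq_transfer` plus the ceiling give slow decrease / slow increase on windows `[t,(1+θ)t]`; `L > 0` from the
infinitely-often hypothesis; the envelope `f t ≥ (L/8) t` eventually. [Karamata 1930; Feller 1971, XIII.5 Theorem 2] -/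
theorem stub_karamataCollapse :
    ∀ (f σ : ℝ → ℝ), (∀ t : ℝ, 0 ≤ t → 0 ≤ σ t) →
      (∀ s t : ℝ, 0 ≤ s → s ≤ t → |σ t - σ s| ≤ σ (t - s)) →
      (∀ t : ℝ, 0 ≤ t → f t = σ t ^ 2) →
      (∃ b : ℝ, ∀ t : ℝ, 0 ≤ t → f t ≤ b * (1 + t)) →
      (∀ ν : ℝ, 0 < ν → MeasureTheory.IntegrableOn (fun t : ℝ => Real.exp (-(ν * t)) * f t) (Set.Ioi 0)) →
      ((∃ L : ℝ, Filter.Tendsto (fun ν : ℝ => ν ^ 2 * ∫ t in Set.Ioi (0:ℝ), Real.exp (-(ν * t)) * f t)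
          (nhdsWithin (0:ℝ) (Set.Ioi 0)) (nhds L)) ∨
        Filter.Tendsto (fun ν : ℝ => ν ^ 2 * ∫ t in Set.Ioi (0:ℝ), Real.exp (-(ν * t)) * f t)
          (nhdsWithin (0:ℝ) (Set.Ioi 0)) Filter.atTop) →
      (∃ m₀ : ℝ, 0 < m₀ ∧ ∀ t₀ : ℝ, ∃ t : ℝ, t₀ ≤ t ∧ m₀ * t ≤ f t) →
      ∃ m t₂ : ℝ, 0 < m ∧ ∀ t : ℝ, t₂ ≤ t → m * t ≤ f t := by
  intro f σ hσ hinc hf hceil hint habel hio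
  -- Step 0: `f ≥ 0` on `[0,∞)` and WLOG `b ≥ 0`.
  have hf0 : ∀ t : ℝ, 0 ≤ t → 0 ≤ f t := fun t ht => by rw [hf t ht]; positivity
  obtain ⟨b, hb0, hb⟩ : ∃ b : ℝ, 0 ≤ b ∧ ∀ t : ℝ, 0 ≤ t → f t ≤ b * (1 + t) := by
    obtain ⟨b, hb⟩ := hceil
    refine ⟨max b 0, le_max_right _ _, fun t ht => (hb t ht).trans ?_⟩
    exact mul_le_mul_of_nonneg_right (le_max_left _ _) (by linarith)
  -- Step 1: the ceiling kills the `atTop` branch, so the Abel means converge to some `L`.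
  obtain ⟨L, hL⟩ : ∃ L : ℝ, Tendsto (fun ν : ℝ => ν ^ 2 * ∫ t in Ioi (0:ℝ), Real.exp (-(ν * t)) * f t)
      (𝓝[>] 0) (𝓝 L) := by
    rcases habel with h | hdiv
    · exact h
    exfalso
    have h1 : ∀ᶠ ν in 𝓝[>] (0:ℝ), 2 * b + 1 ≤ ν ^ 2 * ∫ t in Ioi (0:ℝ), Real.exp (-(ν * t)) * f t :=
      hdiv.eventually_ge_atTop _
    have h2 : ∀ᶠ ν in 𝓝[>] (0:ℝ), ν ∈ Ioo (0:ℝ) 1 := Ioo_mem_nhdsGT one_pos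
    obtain ⟨ν, hν1, hν2⟩ := (h1.and h2).exists
    linarith [laplace_sq_mul_le hb0 hb hν2.1 hν2.2.le (hint ν hν2.1)]
  -- Step 2: Karamata's Tauberian theorem of index 2.
  have hu : ∀ t : ℝ, 0 < t → 0 ≤ f t := fun t ht => hf0 t ht.le
  have hint' : ∀ δ : ℝ, 0 < δ → IntegrableOn (fun t => f t * Real.exp (-(δ * t))) (Ioi 0) :=
    fun δ hδ => (hint δ hδ).congr_fun (fun t _ => mul_comm _ _) measurableSet_Ioi
  have hω : Tendsto (fun δ : ℝ => δ ^ 2 * ∫ t in Ioi (0:ℝ), f t * Real.exp (-(δ * t)))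
      (𝓝[>] 0) (𝓝 L) := by
    refine hL.congr fun δ => ?_
    congr 1
    exact setIntegral_congr_fun measurableSet_Ioi fun t _ => mul_comm _ _
  have hK := karamata_tauberian_laplace_two hu hint' hω
  obtain ⟨F, hFdef⟩ : ∃ F : ℝ → ℝ, ∀ T, F T = ∫ t in Ioc 0 T, f t := ⟨_, fun T => rfl⟩
  have hKF : Tendsto (fun T : ℝ => F T / T ^ 2) atTop (𝓝 (L / 2)) := by
    simp only [hFdef]; exact hK
  -- bookkeeping for `F`
  have hloc : ∀ T : ℝ, IntegrableOn f (Ioc 0 T) := fun T => KaramataLaplace.integrableOn_Ioc hint' T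
  have hII : ∀ a c : ℝ, 0 ≤ a → a ≤ c → IntervalIntegrable f volume a c := fun a c ha hac =>
    (intervalIntegrable_iff_integrableOn_Ioc_of_le hac).2 ((hloc c).mono_set (Ioc_subset_Ioc_left ha))
  have hFint : ∀ T : ℝ, 0 ≤ T → F T = ∫ t in (0:ℝ)..T, f t := fun T hT => by
    rw [hFdef, intervalIntegral.integral_of_le hT]
  have hFsub : ∀ a c : ℝ, 0 ≤ a → a ≤ c → F c - F a = ∫ t in a..c, f t := fun a c ha hac => by
    rw [hFint a ha, hFint c (ha.trans hac)]
    exact intervalIntegral.integral_interval_sub_left (hII 0 c le_rfl (ha.trans hac)) (hII 0 a le_rfl ha)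
  have hFnn : ∀ T : ℝ, 0 ≤ F T := fun T => by
    rw [hFdef]
    exact setIntegral_nonneg measurableSet_Ioc fun t ht => hu t ht.1
  have hFlow : ∀ a c κ : ℝ, 0 ≤ a → a ≤ c → (∀ s : ℝ, a ≤ s → s ≤ c → κ ≤ f s) →
      (c - a) * κ ≤ F c - F a := by
    intro a c κ ha hac h
    rw [hFsub a c ha hac]
    have := intervalIntegral.integral_mono_on (f := fun _ => κ) (g := f) hac intervalIntegrable_const
      (hII a c ha hac) fun s hs => h s hs.1 hs.2
    simpa only [intervalIntegral.integral_const, smul_eq_mul] using this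
  have hFup : ∀ a c κ : ℝ, 0 ≤ a → a ≤ c → (∀ s : ℝ, a ≤ s → s ≤ c → f s ≤ κ) →
      F c - F a ≤ (c - a) * κ := by
    intro a c κ ha hac h
    rw [hFsub a c ha hac]
    have := intervalIntegral.integral_mono_on (f := f) (g := fun _ => κ) hac (hII a c ha hac)
      intervalIntegrable_const fun s hs => h s hs.1 hs.2
    simpa only [intervalIntegral.integral_const, smul_eq_mul] using this
  -- two-sided Karamata bounds
  have hKb : ∀ ε : ℝ, 0 < ε → ∃ T₀ : ℝ, 0 < T₀ ∧ ∀ T : ℝ, T₀ ≤ T →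
      (L / 2 - ε) * T ^ 2 ≤ F T ∧ F T ≤ (L / 2 + ε) * T ^ 2 := by
    intro ε hε
    obtain ⟨N, hN⟩ := Metric.tendsto_atTop.1 hKF ε hε
    refine ⟨max N 1, lt_of_lt_of_le one_pos (le_max_right _ _), fun T hT => ?_⟩
    have hT0 : 0 < T := lt_of_lt_of_le one_pos ((le_max_right _ _).trans hT)
    have hT2 : 0 < T ^ 2 := by positivity
    have h := hN T ((le_max_left _ _).trans hT)
    rw [Real.dist_eq] at h
    obtain ⟨h1, h2⟩ := abs_lt.1 h
    constructor
    · have := (lt_div_iff₀ hT2).1 (by linarith : L / 2 - ε < F T / T ^ 2)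
      linarith
    · have := (div_lt_iff₀ hT2).1 (by linarith : F T / T ^ 2 < L / 2 + ε)
      linarith
  obtain ⟨m₀, hm₀, hio⟩ := hio
  -- Step 4: `L > 0`.
  have hLpos : 0 < L := by
    by_contra hLle
    rw [not_lt] at hLle
    obtain ⟨θ, hθ0, hθ1, hbθ⟩ : ∃ θ : ℝ, 0 < θ ∧ θ ≤ 1 ∧ b * θ ≤ m₀ / 8 := by
      refine ⟨min 1 (m₀ / (8 * (b + 1))), lt_min one_pos (by positivity), min_le_left _ _, ?_⟩
      calc b * min 1 (m₀ / (8 * (b + 1)))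
          ≤ b * (m₀ / (8 * (b + 1))) := mul_le_mul_of_nonneg_left (min_le_right _ _) hb0
        _ ≤ (b + 1) * (m₀ / (8 * (b + 1))) := mul_le_mul_of_nonneg_right (by linarith) (by positivity)
        _ = m₀ / 8 := by field_simp
    obtain ⟨T₀, hT₀, hT⟩ := hKb (θ * m₀ / 32) (by positivity)
    obtain ⟨t, ht, hft⟩ := hio (max T₀ (4 * b / m₀ + 1))
    have htT : T₀ ≤ t := (le_max_left _ _).trans ht
    have ht4 : 4 * b / m₀ + 1 ≤ t := (le_max_right _ _).trans ht
    have ht0 : 0 < t := hT₀.trans_le htT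
    -- slow decrease to the right of the io-time `t`
    have hlowpt : ∀ s : ℝ, t ≤ s → s ≤ (1 + θ) * t → m₀ * t / 2 - b - b * θ * t ≤ f s := by
      intro s hts hs
      have h1 := sq_transfer hσ hinc hf ht0.le hts
      have h2 := hb (s - t) (sub_nonneg.2 hts)
      have h3 : b * (1 + (s - t)) ≤ b * (1 + θ * t) := mul_le_mul_of_nonneg_left (by linarith) hb0
      linarith
    have ht1 : t ≤ (1 + θ) * t := by nlinarith
    have hinc1 := hFlow t ((1 + θ) * t) _ ht0.le ht1 hlowpt
    have hup1 : F ((1 + θ) * t) ≤ (L / 2 + θ * m₀ / 32) * ((1 + θ) * t) ^ 2 := (hT _ (htT.trans ht1)).2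
    have hFt := hFnn t
    have h4 : (L / 2 + θ * m₀ / 32) * ((1 + θ) * t) ^ 2 ≤ θ * m₀ / 32 * (4 * t ^ 2) := by
      have hsq : ((1 + θ) * t) ^ 2 ≤ 4 * t ^ 2 := by
        have h1t : (1 + θ) * t ≤ 2 * t := by nlinarith
        calc ((1 + θ) * t) ^ 2 ≤ (2 * t) ^ 2 := pow_le_pow_left₀ (by positivity) h1t 2
          _ = 4 * t ^ 2 := by ring
      have h5 : (L / 2 + θ * m₀ / 32) * ((1 + θ) * t) ^ 2 ≤ θ * m₀ / 32 * ((1 + θ) * t) ^ 2 :=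
        mul_le_mul_of_nonneg_right (by linarith) (by positivity)
      exact h5.trans (mul_le_mul_of_nonneg_left hsq (by positivity))
    have key : θ * t * (m₀ * t / 2 - b - b * θ * t) ≤ θ * t * (m₀ * t / 8) := by
      have e1 : (1 + θ) * t - t = θ * t := by ring
      have e2 : θ * m₀ / 32 * (4 * t ^ 2) = θ * t * (m₀ * t / 8) := by ring
      rw [e1] at hinc1
      linarith
    have key2 := le_of_mul_le_mul_left key (by positivity : 0 < θ * t)
    have h5 : b * θ * t ≤ m₀ / 8 * t := mul_le_mul_of_nonneg_right hbθ ht0.le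
    have h6 : m₀ * (4 * b / m₀ + 1) ≤ m₀ * t := mul_le_mul_of_nonneg_left ht4 hm₀.le
    have h7 : m₀ * (4 * b / m₀ + 1) = 4 * b + m₀ := by field_simp
    linarith
  -- Step 5: the eventual linear lower envelope.
  obtain ⟨θ, hθ0, hθ1, hbθ⟩ : ∃ θ : ℝ, 0 < θ ∧ θ ≤ 1 / 2 ∧ b * θ ≤ L / 16 := by
    refine ⟨min (1 / 2) (L / (16 * (b + 1))), lt_min (by norm_num) (by positivity), min_le_left _ _, ?_⟩
    calc b * min (1 / 2) (L / (16 * (b + 1)))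
        ≤ b * (L / (16 * (b + 1))) := mul_le_mul_of_nonneg_left (min_le_right _ _) hb0
      _ ≤ (b + 1) * (L / (16 * (b + 1))) := mul_le_mul_of_nonneg_right (by linarith) (by positivity)
      _ = L / 16 := by field_simp
  obtain ⟨T₀, hT₀, hT⟩ := hKb (L * θ / 8) (by positivity)
  refine ⟨L / 8, max (2 * T₀) (16 * b / L), by positivity, fun t ht => ?_⟩
  have htT : 2 * T₀ ≤ t := (le_max_left _ _).trans ht
  have htb : 16 * b / L ≤ t := (le_max_right _ _).trans ht
  have ht0 : 0 < t := by linarith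
  -- the window `[a, t]`, `a = (1 - θ) t`
  obtain ⟨a, ha⟩ : ∃ a : ℝ, a = (1 - θ) * t := ⟨_, rfl⟩
  have ha0 : 0 ≤ a := by rw [ha]; exact mul_nonneg (by linarith) ht0.le
  have hat : a ≤ t := by rw [ha]; nlinarith
  have haT : T₀ ≤ a := by
    have : 1 / 2 * t ≤ (1 - θ) * t := mul_le_mul_of_nonneg_right (by linarith) ht0.le
    rw [ha]; linarith
  -- slow increase to the left of `t`
  have huppt : ∀ s : ℝ, a ≤ s → s ≤ t → f s ≤ 2 * f t + 2 * b + 2 * b * θ * t := by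
    intro s has hst
    have hs0 : 0 ≤ s := ha0.trans has
    have h1 := sq_transfer hσ hinc hf hs0 hst
    have h2 := hb (t - s) (sub_nonneg.2 hst)
    rw [ha] at has
    have h3 : b * (1 + (t - s)) ≤ b * (1 + θ * t) := mul_le_mul_of_nonneg_left (by linarith) hb0
    linarith
  have hinc2 := hFup a t _ ha0 hat huppt
  have hlowt : (L / 2 - L * θ / 8) * t ^ 2 ≤ F t := (hT t (by linarith)).1
  have hupa : F a ≤ (L / 2 + L * θ / 8) * a ^ 2 := (hT a haT).2
  have key : θ * t * (L * t / 2) ≤ θ * t * (2 * f t + 2 * b + 2 * b * θ * t) := by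
    have hta : t - a = θ * t := by rw [ha]; ring
    rw [hta] at hinc2
    have hq : 0 ≤ 1 / 4 - θ / 4 - θ ^ 2 / 8 := by nlinarith
    have hpos : 0 ≤ t ^ 2 * L * θ * (1 / 4 - θ / 4 - θ ^ 2 / 8) :=
      mul_nonneg (by positivity) hq
    have hid : (L / 2 - L * θ / 8) * t ^ 2 - (L / 2 + L * θ / 8) * a ^ 2 - θ * t * (L * t / 2) =
        t ^ 2 * L * θ * (1 / 4 - θ / 4 - θ ^ 2 / 8) := by
      rw [ha]; ring
    linarith
  have key2 := le_of_mul_le_mul_left key (by positivity : 0 < θ * t)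
  have h5 : b * θ * t ≤ L / 16 * t := mul_le_mul_of_nonneg_right hbθ ht0.le
  have h6 : L * (16 * b / L) ≤ L * t := mul_le_mul_of_nonneg_left htb hLpos.le
  have h7 : L * (16 * b / L) = 16 * b := by field_simp
  linarith

end Summit.AtomisticToContinuum.FouriersLaw.Theorems.LinearSpread.KaramataCollapse
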